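import Mathlib
import HarnessLib
import Summits.Ventures.LatticeQCDFlow.Exactness.U1MultiStepFTHMCErgodic
import Summits.Ventures.LatticeQCDFlow.Exactness.U1WilsonFlowLOMemberErgodic

/-!
# Multi-step FT-HMC through the engine's `U(1)` LO Wilson-flow member (any schedule) is uniformly ergodic for short trajectories

HONEST FRAMING: exact (Metropolis-corrected) sampling algorithms for lattice gauge theory;
figures of merit are autocorrelation/cost numbers at stated couplings and volumes; no
continuum-physics claim.

Venture `LatticeQCDFlow` (cell pub-lqcd), topic `Exactness`, FANOUT row 14 (`eng-flowhmc`, engine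
`latflow.fthmc`, family B, `U(1)` rung, member `maps.u1_wilson_flow_lo`, multi-step trajectories).
NEW WORK of the cell over ROW 9's `U1MultiStepFTHMCErgodic.lean` (landed 09:39Z today:
`u1LeapfrogFTHMCN_uniformlyErgodic` / `_invariant_unique` — FT-HMC through ANY pinched-Jacobian
measurable equivalence at every `nstep` under `4·Lip(g)·ε·n² ≤ 3`) and GEN-9's
`U1WilsonFlowLOMemberErgodic.lean` (`exists_layers_u1WilsonFlowLO` packaging,
`u1WilsonFlowLO_layers_pinched`, `foldr_logDet_mem_Icc`, `hasJacobian_foldr_trans`); nothing is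
cited as a fact; no number.  THE INSTANCE row 9 leaves open ("a particular flow member"):

* **`u1WilsonFlowLO_member_fthmcN_uniformlyErgodic`** / **`u1WilsonFlowLO_member_fthmcN_invariant_unique`**
  — the engine's whole `U(1)` LO Wilson-flow member, ANY schedule, layers packaged VERBATIM as in
  `exists_layers_u1WilsonFlowLO` (proper colouring, `2(d−1)|ε| < 1`): multi-step FT-HMC through it
  (row 9's kernel `u1LeapfrogHMCN` for `S∘F − log J`, reported through the member) converges to
  `π_S` geometrically from EVERY start and `π_S` is its unique invariant probability law, for every
  measurable `|S| ≤ s'`, increment `‖g u l‖ ≤ b'` `K`-Lipschitz with `4Kε'n² ≤ 3`, `ε', κ' > 0`, `n ≥ 1`.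

NOT CLAIMED: the Lipschitz constant of the engine's autodiff force through the member (taken
abstractly); longer trajectories; learned members (`U1MaskedLayerErgodic`); OMF words
(`U1Omf2FTHMCErgodic`); `SU(2)`; any usable `δ`; floating point; any number.
-/

noncomputable section

namespace Summit.Ventures.LatticeQCDFlow.Exactness

open MeasureTheory ProbabilityTheory ProbabilityTheory.Kernel Set
open Literature.MathematicalPhysics.QuantumFieldTheory
open scoped ENNReal NNReal

/-! ## The engine's `U(1)` LO Wilson-flow member (any schedule): multi-step FT-HMC through it -/

section U1LO

variable {d L : ℕ} {X : Type*} [DecidableEq X] (χ : Site d L → X) [NeZero L]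

/-- **MULTI-STEP FT-HMC through the engine's whole `U(1)` LO Wilson-flow member — ANY schedule —
is uniformly ergodic for short trajectories.**  Proper colouring `χ`, `2(d−1)|ε| < 1`, layers
packaged VERBATIM as in `exists_layers_u1WilsonFlowLO`; any measurable `|S| ≤ s'`; momentum
increment `‖g u l‖ ≤ b'`, `K`-Lipschitz with `4Kε'n² ≤ 3`; `ε', κ' > 0`, `n ≥ 1`. -/
theorem u1WilsonFlowLO_member_fthmcN_uniformlyErgodic
    (hχ : ∀ (x : Site d L) (i : Fin d), χ (x.shift i) ≠ χ x) {ε : ℝ}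
    (hε : |ε| * (2 * ((d - 1 : ℕ) : ℝ)) < 1) (sched : List (Fin d × X))
    {ε' κ' : ℝ} (hε' : 0 < ε') (hκ' : 0 < κ') {n : ℕ} (hn : 1 ≤ n)
    {g : GaugeConfig d L Circle → Edge d L → ℝ} (hg : Measurable g) {K : ℝ≥0}
    (hgK : LipschitzWith K g) (hshort : 4 * (K : ℝ) * ε' * (n : ℝ) ^ 2 ≤ 3) {b' : ℝ} (hb0 : 0 ≤ b')
    (hb : ∀ u l, ‖g u l‖ ≤ b')
    {S : GaugeConfig d L Circle → ℝ} (hS : Measurable S) {s' : ℝ} (hs : ∀ u, |S u| ≤ s') :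
    ∃ layers : List ((GaugeConfig d L Circle ≃ᵐ GaugeConfig d L Circle) × (GaugeConfig d L Circle → ℝ)),
      layers.map (fun Ly => ((Ly.1 : GaugeConfig d L Circle → GaugeConfig d L Circle), Ly.2)) = sched.map (fun s =>
        ((fun (V : GaugeConfig d L Circle) (e : Edge d L) => if e.2 = s.1 ∧ χ e.1 = s.2 then
          V e * Circle.exp (ε * ∑ ν ∈ Finset.univ.erase e.2,
            (((plaquetteHolonomy V (e.1 - Pi.single ν 1) e.2 ν : Circle) : ℂ).im -
              ((plaquetteHolonomy V e.1 e.2 ν : Circle) : ℂ).im)) else V e),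
         fun V : GaugeConfig d L Circle => ∏ a : {e : Edge d L // e.2 = s.1 ∧ χ e.1 = s.2},
          (1 - ε * ∑ ν ∈ Finset.univ.erase a.1.2,
            (((plaquetteHolonomy V a.1.1 a.1.2 ν : Circle) : ℂ).re +
              ((plaquetteHolonomy V (a.1.1 - Pi.single ν 1) a.1.2 ν : Circle) : ℂ).re)))) ∧
      ∃ δ : ℝ, 0 < δ ∧ δ ≤ 1 ∧ ∀ (μ₀ : Measure (GaugeConfig d L Circle)) [IsProbabilityMeasure μ₀]
        (t : ℕ) (A : Set (GaugeConfig d L Circle)),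
        |((fun m : Measure (GaugeConfig d L Circle) =>
              m.bind (conjKernel (u1LeapfrogHMCN ε' κ' hg (fun V =>
                  S ((layers.foldr (fun Ly (F : GaugeConfig d L Circle ≃ᵐ GaugeConfig d L Circle) =>
                      Ly.1.trans F) (MeasurableEquiv.refl (GaugeConfig d L Circle))) V) -
                    Real.log ((layers.foldr (fun Ly K => fun v => Ly.2 v * K (Ly.1 v))
                      (fun _ => (1 : ℝ))) V)) n)
                (layers.foldr (fun Ly (F : GaugeConfig d L Circle ≃ᵐ GaugeConfig d L Circle) =>
                  Ly.1.trans F) (MeasurableEquiv.refl (GaugeConfig d L Circle)))))^[t] μ₀).real A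
            - (u1GibbsLaw S).real A| ≤ (1 - δ) ^ t := by
  obtain ⟨layers, hmap, hpos, hmeas, hjac⟩ := exists_layers_u1WilsonFlowLO χ hχ hε sched
  refine ⟨layers, hmap, ?_⟩
  obtain ⟨-, hfmeas, hfjac⟩ := hasJacobian_foldr_trans layers hpos hmeas hjac
  have hpinch := u1WilsonFlowLO_layers_pinched χ hε.le sched layers hmap
  have h0 : 0 < 1 - |ε| * (2 * ((d - 1 : ℕ) : ℝ)) := by linarith
  have hfold := fun v => foldr_logDet_mem_Icc layers (pow_nonneg h0.le _) hpinch v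
  exact u1LeapfrogFTHMCN_uniformlyErgodic hε' hκ' hn hg hgK hshort hb0 hb hS hs
    (pow_pos (pow_pos h0 _) _) (fun v => (hfold v).1) (fun v => (hfold v).2) hfmeas hfjac

/-- **… and `π_S` is the unique invariant probability law of the member's reported `n`-step
kernel** (same hypotheses). -/
theorem u1WilsonFlowLO_member_fthmcN_invariant_unique
    (hχ : ∀ (x : Site d L) (i : Fin d), χ (x.shift i) ≠ χ x) {ε : ℝ}
    (hε : |ε| * (2 * ((d - 1 : ℕ) : ℝ)) < 1) (sched : List (Fin d × X))
    {ε' κ' : ℝ} (hε' : 0 < ε') (hκ' : 0 < κ') {n : ℕ} (hn : 1 ≤ n)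
    {g : GaugeConfig d L Circle → Edge d L → ℝ} (hg : Measurable g) {K : ℝ≥0}
    (hgK : LipschitzWith K g) (hshort : 4 * (K : ℝ) * ε' * (n : ℝ) ^ 2 ≤ 3) {b' : ℝ} (hb0 : 0 ≤ b')
    (hb : ∀ u l, ‖g u l‖ ≤ b')
    {S : GaugeConfig d L Circle → ℝ} (hS : Measurable S) {s' : ℝ} (hs : ∀ u, |S u| ≤ s') :
    ∃ layers : List ((GaugeConfig d L Circle ≃ᵐ GaugeConfig d L Circle) × (GaugeConfig d L Circle → ℝ)),
      layers.map (fun Ly => ((Ly.1 : GaugeConfig d L Circle → GaugeConfig d L Circle), Ly.2)) = sched.map (fun s =>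
        ((fun (V : GaugeConfig d L Circle) (e : Edge d L) => if e.2 = s.1 ∧ χ e.1 = s.2 then
          V e * Circle.exp (ε * ∑ ν ∈ Finset.univ.erase e.2,
            (((plaquetteHolonomy V (e.1 - Pi.single ν 1) e.2 ν : Circle) : ℂ).im -
              ((plaquetteHolonomy V e.1 e.2 ν : Circle) : ℂ).im)) else V e),
         fun V : GaugeConfig d L Circle => ∏ a : {e : Edge d L // e.2 = s.1 ∧ χ e.1 = s.2},
          (1 - ε * ∑ ν ∈ Finset.univ.erase a.1.2,
            (((plaquetteHolonomy V a.1.1 a.1.2 ν : Circle) : ℂ).re +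
              ((plaquetteHolonomy V (a.1.1 - Pi.single ν 1) a.1.2 ν : Circle) : ℂ).re)))) ∧
      ∀ (π' : Measure (GaugeConfig d L Circle)) [IsProbabilityMeasure π'],
        Invariant (conjKernel (u1LeapfrogHMCN ε' κ' hg (fun V =>
              S ((layers.foldr (fun Ly (F : GaugeConfig d L Circle ≃ᵐ GaugeConfig d L Circle) =>
                  Ly.1.trans F) (MeasurableEquiv.refl (GaugeConfig d L Circle))) V) -
                Real.log ((layers.foldr (fun Ly K => fun v => Ly.2 v * K (Ly.1 v))
                  (fun _ => (1 : ℝ))) V)) n)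
            (layers.foldr (fun Ly (F : GaugeConfig d L Circle ≃ᵐ GaugeConfig d L Circle) =>
              Ly.1.trans F) (MeasurableEquiv.refl (GaugeConfig d L Circle)))) π' →
        π' = u1GibbsLaw S := by
  obtain ⟨layers, hmap, hpos, hmeas, hjac⟩ := exists_layers_u1WilsonFlowLO χ hχ hε sched
  refine ⟨layers, hmap, fun π' _ hπ' => ?_⟩
  obtain ⟨-, hfmeas, hfjac⟩ := hasJacobian_foldr_trans layers hpos hmeas hjac
  have hpinch := u1WilsonFlowLO_layers_pinched χ hε.le sched layers hmap
  have h0 : 0 < 1 - |ε| * (2 * ((d - 1 : ℕ) : ℝ)) := by linarith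
  have hfold := fun v => foldr_logDet_mem_Icc layers (pow_nonneg h0.le _) hpinch v
  exact u1LeapfrogFTHMCN_invariant_unique hε' hκ' hn hg hgK hshort hb0 hb hS hs
    (pow_pos (pow_pos h0 _) _) (fun v => (hfold v).1) (fun v => (hfold v).2) hfmeas hfjac hπ'

end U1LO

end Summit.Ventures.LatticeQCDFlow.Exactness
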